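import Literature.NumberTheory.LFunctions.WeilExplicit
import Literature.NumberTheory.LFunctions.RiemannXi
import Summits.RiemannHypothesis.RiemannHypothesis.Theorems.HandoffHarmonicDivides
import Summits.RiemannHypothesis.RiemannHypothesis.Theorems.HandoffGaussTail
import HarnessLib

/-!
# H-RIG along route B″ — file 1/7 of the split of `HandoffHRig` (handoff-idea-3 gen 26)

§0–§1 vocabulary (`gammaEnv`) + S1 `mellinSide_of_gaussTail` (Mellin side from the rate-π tails).
See the module docstring of `HandoffHRig.lean` (the last file) for the theorem `hRig_holds (D : ℕ) : HRig D`,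
the route B″ and the references.  Nothing in this file bears on the truth of RH. [folklore]
-/

set_option linter.dupNamespace false

noncomputable section

open Complex MeasureTheory Set Filter Asymptotics
open scoped Real Topology
open Literature.NumberTheory.LFunctions
open Summit.RiemannHypothesis.RiemannHypothesis.Theorems.HandoffHarmonicDivides
  (hasDerivAt_weilMellin_of_expMoments)
open Summit.RiemannHypothesis.RiemannHypothesis.Theorems.HandoffGaussTail
  (one_add_pow_mul_exp_neg_le)

namespace Summit.RiemannHypothesis.RiemannHypothesis.Theorems.HandoffHRig

/-! ## §0 Vocabulary (the formulas are gen 25's `HandoffHardyRigidity.lean` predicates, UNFOLDED exactly as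
theory-1's tree files unfold them) -/

/-! Informal names used in the docstrings (all statements below are UNFOLDED — the tree audit admits no
unregistered `Prop` definitions under `Summits/`):
* `GaussTail D v`   — TWO-SIDED RATE-π GAUSSIAN TAILS OF ORDER `D`:
                      `∃ C, ∀ t, ‖v t‖ ≤ C (1 + e^{2|t|})^D e^{|t|/2 − π e^{2|t|}}` (the theta ground state has order 2);
* `XiDivides v`     — `ξ ∣ v̂` in the ring of entire functions: `∃ m entire, weilMellin v = m · ξ`;
* `MellinLadder D v`— `∃ P : Polynomial ℂ, (∀ k, D ≤ k+1 → P.coeff k = 0) ∧ weilMellin v = P · ξ` (`deg P ≤ D − 2`). -/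

/-! ## §1 Intermediate notions of route B″ (the `Prop`s `XiDivisionCost`, `SectorPL`, `HRig` are defined next
to their proofs in S2, S4, §3, so that every file of the 400-line split carries its own witnesses) -/

/-- The Gamma envelope `π^{−u/2} Γ(u/2 + D)` — the size of `∫ ‖v‖ e^{(u−½)t} dt` for `v ∈ GaussTail D`
at abscissa `u ≥ 2` (substitute `λ = π e^{2t}`). [folklore] -/
def gammaEnv (D : ℕ) (u : ℝ) : ℝ :=
  π ^ (-u / 2) * Real.Gamma (u / 2 + D)

/-- `gammaEnv D u > 0` for `u > 0`. [folklore] -/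
theorem gammaEnv_pos (D : ℕ) {u : ℝ} (hu : 0 < u) : 0 < gammaEnv D u :=
  mul_pos (Real.rpow_pos_of_pos Real.pi_pos _) (Real.Gamma_pos_of_pos (by positivity))

/-! More informal names (unfolded in all statements):
* `MellinSide D v`    — `weilMellin v` entire, bounded on every closed vertical strip, and
                        `‖v̂(s)‖ ≤ C·gammaEnv D σ` (`σ ≥ 2`), `≤ C·gammaEnv D (1−σ)` (`σ ≤ −1`);
* `StripGrowth m`     — `∃ c < π/3, ∃ A, ‖m(s)‖ ≤ exp(A e^{c|τ|})` on `−1 ≤ σ ≤ 2`;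
* `ExteriorBounds N m`— one constant `K`: `‖m(s)‖ ≤ K(1+‖s‖)^N e^{(π/4)|τ|}` for `σ ≥ 2` and for `σ ≤ −1`,
                        and `≤ K(1+‖s‖)^N e^{ε|τ|}` in thin sectors `|τ| ≤ α_ε σ` / `|τ| ≤ α_ε(1−σ)`;
* `PolyBound N m`     — `∃ C, ∀ s, ‖m s‖ ≤ C(1+‖s‖)^N`;
* `RealAxisDecay D m` — `∃ K, ∀ σ ≥ 2, ‖m(σ)‖σ² ≤ Kσ^D`. -/

/-! ## §2 The six steps S1–S6 of route B″ — all PROVED (no `sorry` anywhere in this file) -/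

/-! ### S1 — Mellin side from the tails — PROVED (no sorry).
`v ∈ GaussTail D` measurable ⇒ `v̂` entire (XX-c `hasDerivAt_weilMellin_of_expMoments` with the
exponential moments below), bounded on vertical strips, and the Gamma majorant: the symmetrisation
`e^{(σ−½)t} ≤ e^{|σ−½|·|t|}` bounds BOTH halves of `∫‖v‖e^{(σ−½)t}` by `2∫₀^∞ env(t) e^{(u−½)t} dt`
(`u = σ` or `1 − σ`), `(1+e^{2t})^D ≤ 2^D e^{2Dt}`, and the substitution `x = e^{2t}`
(`MeasureTheory.integral_comp_mul_deriv_Ioi`) turns `∫₀^∞ e^{(2D+u)t − πe^{2t}} dt` into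
`½∫₁^∞ x^{u/2+D−1} e^{−πx} dx ≤ ½ π^{−(u/2+D)} Γ(u/2+D)` (`Real.integral_rpow_mul_exp_neg_mul_Ioi`). -/

/-! ### S1.E The order-`D` rate-`π` envelope beats every exponential -/

/-- `(1+e^{2u})^D e^{u/2 − πe^{2u}} e^{cu} ≤ K_{D,c} e^{−u}` for `u ≥ 0`. -/
theorem env_mul_exp_le (D : ℕ) (c : ℝ) : ∃ K : ℝ, 0 ≤ K ∧ ∀ u : ℝ, 0 ≤ u →
    (1 + Real.exp (2 * u)) ^ D * Real.exp (u / 2 - π * Real.exp (2 * u)) * Real.exp (c * u) ≤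
      K * Real.exp (-u) := by
  set b : ℝ := c + 3 / 2 - π with hb
  refine ⟨2 ^ D * D.factorial * Real.exp (1 / 2) * Real.exp (b ^ 2 / 12), by positivity,
    fun u hu => ?_⟩
  set z : ℝ := π * Real.exp (2 * u) with hz
  have hz0 : 0 ≤ z := by positivity
  have hπ3 := Real.pi_gt_three
  -- (1 + e^{2u})^D ≤ (1 + z)^D
  have h1 : (1 + Real.exp (2 * u)) ^ D ≤ (1 + z) ^ D := by
    apply pow_le_pow_left₀ (by positivity)
    have : Real.exp (2 * u) ≤ z := by
      rw [hz]; nlinarith [Real.exp_pos (2 * u)]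
    linarith
  -- XX-a: (1+z)^D e^{-z} ≤ K_D e^{-z/2}
  have h2 := one_add_pow_mul_exp_neg_le D hz0
  -- the exponent bookkeeping
  have hq : 1 + 2 * u + 2 * u ^ 2 ≤ Real.exp (2 * u) := by
    have h := Real.quadratic_le_exp_of_nonneg (by positivity : (0:ℝ) ≤ 2 * u)
    nlinarith
  have hE : u / 2 + c * u + u - z / 2 ≤ b ^ 2 / 12 := by
    have hz' : π / 2 + π * u + π * u ^ 2 ≤ z / 2 := by
      rw [hz]; nlinarith [Real.pi_pos]
    have hsq : b * u - 3 * u ^ 2 ≤ b ^ 2 / 12 := by nlinarith [sq_nonneg (u - b / 6)]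
    nlinarith [sq_nonneg u, Real.pi_pos]
  -- assemble
  have hsplit : Real.exp (u / 2 - π * Real.exp (2 * u)) * Real.exp (c * u) =
      Real.exp (-z) * Real.exp (u / 2 + c * u) := by
    rw [← Real.exp_add, ← Real.exp_add]; congr 1; rw [hz]; ring
  calc (1 + Real.exp (2 * u)) ^ D * Real.exp (u / 2 - π * Real.exp (2 * u)) * Real.exp (c * u)
      = (1 + Real.exp (2 * u)) ^ D * (Real.exp (-z) * Real.exp (u / 2 + c * u)) := by
        rw [mul_assoc, hsplit]
    _ ≤ (1 + z) ^ D * (Real.exp (-z) * Real.exp (u / 2 + c * u)) :=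
        mul_le_mul_of_nonneg_right h1 (by positivity)
    _ = (1 + z) ^ D * Real.exp (-z) * Real.exp (u / 2 + c * u) := by ring
    _ ≤ 2 ^ D * D.factorial * Real.exp (1 / 2) * Real.exp (-(z / 2)) * Real.exp (u / 2 + c * u) :=
        mul_le_mul_of_nonneg_right h2 (by positivity)
    _ = 2 ^ D * D.factorial * Real.exp (1 / 2) * Real.exp ((u / 2 + c * u + u - z / 2) + -u) := by
        rw [mul_assoc (2 ^ D * (D.factorial : ℝ) * Real.exp (1 / 2)), ← Real.exp_add]
        congr 2; ring
    _ ≤ 2 ^ D * D.factorial * Real.exp (1 / 2) * (Real.exp (b ^ 2 / 12) * Real.exp (-u)) := by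
        rw [Real.exp_add]
        gcongr
    _ = _ := by ring

/-- Two-sided version with `|t|`. -/
theorem env_abs_mul_exp_le (D : ℕ) (c : ℝ) : ∃ K : ℝ, 0 ≤ K ∧ ∀ t : ℝ,
    (1 + Real.exp (2 * |t|)) ^ D * Real.exp (|t| / 2 - π * Real.exp (2 * |t|)) *
      Real.exp (c * |t|) ≤ K * Real.exp (-(1:ℝ) * |t|) := by
  obtain ⟨K, hK0, hK⟩ := env_mul_exp_le D c
  exact ⟨K, hK0, fun t => by simpa [neg_one_mul] using hK |t| (abs_nonneg t)⟩

/-- Exponential moments of every order for a measurable `v` with the order-`D` Gaussian tail. -/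
theorem integrable_norm_mul_exp {D : ℕ} {v : ℝ → ℂ} (hm : AEStronglyMeasurable v volume)
    (hG : (∃ C : ℝ, ∀ t : ℝ,
        ‖v t‖ ≤ C * (1 + Real.exp (2 * |t|)) ^ D * Real.exp (|t| / 2 - π * Real.exp (2 * |t|))))
    (A : ℝ) : Integrable fun t : ℝ => ‖v t‖ * Real.exp (A * |t|) := by
  obtain ⟨C, hC⟩ := hG
  obtain ⟨K, hK0, hK⟩ := env_abs_mul_exp_le D A
  have hgI : Integrable (fun t : ℝ => |C| * K * Real.exp (-(1 : ℝ) * |t|)) :=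
    (Literature.Analysis.Complex.integrable_exp_neg_mul_abs (by norm_num : (0:ℝ) < 1)).const_mul _
  refine hgI.mono' (hm.norm.mul (by fun_prop)) (ae_of_all _ fun t => ?_)
  rw [Real.norm_eq_abs, abs_of_nonneg (by positivity)]
  have hC' : ‖v t‖ ≤ |C| * ((1 + Real.exp (2 * |t|)) ^ D *
      Real.exp (|t| / 2 - π * Real.exp (2 * |t|))) := by
    refine (hC t).trans ?_
    rw [mul_assoc]
    exact mul_le_mul_of_nonneg_right (le_abs_self C) (by positivity)
  calc ‖v t‖ * Real.exp (A * |t|)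
      ≤ |C| * ((1 + Real.exp (2 * |t|)) ^ D * Real.exp (|t| / 2 - π * Real.exp (2 * |t|))) *
          Real.exp (A * |t|) := mul_le_mul_of_nonneg_right hC' (Real.exp_pos _).le
    _ = |C| * ((1 + Real.exp (2 * |t|)) ^ D * Real.exp (|t| / 2 - π * Real.exp (2 * |t|)) *
          Real.exp (A * |t|)) := by ring
    _ ≤ |C| * (K * Real.exp (-(1:ℝ) * |t|)) := mul_le_mul_of_nonneg_left (hK t) (abs_nonneg C)
    _ = |C| * K * Real.exp (-(1:ℝ) * |t|) := by ring

/-! ### S1.F Pointwise-to-integral bounds for `v̂` -/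

/-- `‖v̂(s)‖ ≤ ∫ ‖v(t)‖ e^{M|t|} dt` whenever `|re s − ½| ≤ M`. -/
theorem norm_weilMellin_le {D : ℕ} {v : ℝ → ℂ} (hm : AEStronglyMeasurable v volume)
    (hG : (∃ C : ℝ, ∀ t : ℝ,
        ‖v t‖ ≤ C * (1 + Real.exp (2 * |t|)) ^ D * Real.exp (|t| / 2 - π * Real.exp (2 * |t|))))
    {s : ℂ} {M : ℝ} (hM : |s.re - 1 / 2| ≤ M) :
    ‖weilMellin v s‖ ≤ ∫ t : ℝ, ‖v t‖ * Real.exp (M * |t|) := by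
  unfold weilMellin
  refine norm_integral_le_of_norm_le (integrable_norm_mul_exp hm hG M) (ae_of_all _ fun t => ?_)
  rw [norm_mul, Complex.norm_exp]
  refine mul_le_mul_of_nonneg_left (Real.exp_le_exp.2 ?_) (norm_nonneg _)
  have hre : ((s - 1 / 2) * (t : ℂ)).re = (s.re - 1 / 2) * t := by simp [sub_re, mul_re]
  rw [hre]
  calc (s.re - 1 / 2) * t ≤ |(s.re - 1 / 2) * t| := le_abs_self _
    _ = |s.re - 1 / 2| * |t| := abs_mul _ _
    _ ≤ M * |t| := mul_le_mul_of_nonneg_right hM (abs_nonneg _)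

/-! ### S1.G The Gamma majorant: substitution `x = e^{2t}` -/

/-- `t ↦ e^{2at − πe^{2t}}` is integrable on `[0, ∞)`. -/
theorem integrableOn_expexp (a : ℝ) :
    IntegrableOn (fun t : ℝ => Real.exp (2 * a * t - π * Real.exp (2 * t))) (Ici 0) := by
  obtain ⟨K, hK0, hK⟩ := env_mul_exp_le 0 (2 * a - 1 / 2)
  have hKI : IntegrableOn (fun t : ℝ => K * Real.exp (-(1:ℝ) * |t|)) (Ici 0) :=
    ((Literature.Analysis.Complex.integrable_exp_neg_mul_abs
      (by norm_num : (0:ℝ) < 1)).const_mul K).integrableOn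
  refine Integrable.mono' hKI
    (by fun_prop : Continuous fun t : ℝ =>
      Real.exp (2 * a * t - π * Real.exp (2 * t))).aestronglyMeasurable ?_
  refine (ae_restrict_iff' measurableSet_Ici).2 (ae_of_all _ fun t (ht : 0 ≤ t) => ?_)
  rw [Real.norm_eq_abs, Real.abs_exp]
  have h := hK t ht
  simp only [pow_zero, one_mul] at h
  calc Real.exp (2 * a * t - π * Real.exp (2 * t))
      = Real.exp (t / 2 - π * Real.exp (2 * t)) * Real.exp ((2 * a - 1 / 2) * t) := by
        rw [← Real.exp_add]; congr 1; ring
    _ ≤ K * Real.exp (-t) := h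
    _ = K * Real.exp (-(1:ℝ) * |t|) := by rw [abs_of_nonneg ht, neg_one_mul]

/-- `∫₀^∞ e^{2at − πe^{2t}} dt ≤ ½ π^{−a} Γ(a)` for `a > 0` (substitute `x = e^{2t}`, extend the
resulting integral over `(1, ∞)` to `(0, ∞)`). -/
theorem integral_expexp_le {a : ℝ} (ha : 0 < a) :
    ∫ t in Ioi (0:ℝ), Real.exp (2 * a * t - π * Real.exp (2 * t)) ≤
      1 / 2 * ((1 / π) ^ a * Real.Gamma a) := by
  set g : ℝ → ℝ := fun x => 1 / 2 * (x ^ (a - 1) * Real.exp (-(π * x))) with hg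
  have key := Real.integral_rpow_mul_exp_neg_mul_Ioi ha Real.pi_pos
  have hgI0 : IntegrableOn (fun x : ℝ => x ^ (a - 1) * Real.exp (-(π * x))) (Ioi 0) :=
    .of_integral_ne_zero (by rw [key]; positivity)
  have himg1 : (fun t : ℝ => Real.exp (2 * t)) '' Ioi (0:ℝ) ⊆ Ioi 0 := by
    rintro _ ⟨t, -, rfl⟩; exact Real.exp_pos _
  have himg2 : (fun t : ℝ => Real.exp (2 * t)) '' Ici (0:ℝ) ⊆ Ioi 0 := by
    rintro _ ⟨t, -, rfl⟩; exact Real.exp_pos _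
  have hpt : ∀ t : ℝ, (g ∘ fun t : ℝ => Real.exp (2 * t)) t * (Real.exp (2 * t) * 2) =
      Real.exp (2 * a * t - π * Real.exp (2 * t)) := by
    intro t
    simp only [Function.comp_apply, hg]
    rw [← Real.exp_mul]
    have e1 : 1 / 2 * (Real.exp (2 * t * (a - 1)) * Real.exp (-(π * Real.exp (2 * t)))) *
        (Real.exp (2 * t) * 2) =
        Real.exp (2 * t * (a - 1)) * Real.exp (-(π * Real.exp (2 * t))) * Real.exp (2 * t) := by
      ring
    rw [e1, ← Real.exp_add, ← Real.exp_add]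
    congr 1; ring
  have hsub : ∫ t in Ioi (0:ℝ), (g ∘ fun t : ℝ => Real.exp (2 * t)) t * (Real.exp (2 * t) * 2) =
      ∫ x in Ioi (Real.exp (2 * 0)), g x := by
    refine integral_comp_mul_deriv_Ioi (f := fun t : ℝ => Real.exp (2 * t))
      (f' := fun t : ℝ => Real.exp (2 * t) * 2) (g := g) (a := 0) ?_ ?_ ?_ ?_ ?_ ?_
    · fun_prop
    · exact Real.tendsto_exp_atTop.comp (tendsto_id.const_mul_atTop two_pos)
    · intro x _
      have h1 : HasDerivAt (fun t : ℝ => 2 * t) 2 x := by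
        simpa using (hasDerivAt_id' x).const_mul (2:ℝ)
      exact h1.exp.hasDerivWithinAt
    · refine ContinuousOn.mono (fun x hx => ?_) himg1
      have hx0 : x ≠ 0 := ne_of_gt hx
      exact (continuousAt_const.mul ((Real.continuousAt_rpow_const x (a - 1) (Or.inl hx0)).mul
        (by fun_prop : Continuous fun x : ℝ => Real.exp (-(π * x))).continuousAt)).continuousWithinAt
    · exact IntegrableOn.mono_set (hgI0.const_mul (1 / 2)) himg2
    · have heq : (fun t : ℝ => (g ∘ fun t : ℝ => Real.exp (2 * t)) t * (Real.exp (2 * t) * 2)) =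
          fun t : ℝ => Real.exp (2 * a * t - π * Real.exp (2 * t)) := funext hpt
      rw [heq]; exact integrableOn_expexp a
  have hL : ∫ t in Ioi (0:ℝ), Real.exp (2 * a * t - π * Real.exp (2 * t)) = ∫ x in Ioi (1:ℝ), g x := by
    rw [← setIntegral_congr_fun measurableSet_Ioi (fun t _ => hpt t), hsub]
    norm_num
  have hmono : ∫ x in Ioi (1:ℝ), g x ≤ ∫ x in Ioi (0:ℝ), g x := by
    refine setIntegral_mono_set (hgI0.const_mul (1 / 2)) ?_
      ((show Ioi (1:ℝ) ≤ Ioi 0 from Ioi_subset_Ioi zero_le_one).eventuallyLE)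
    refine (ae_restrict_iff' measurableSet_Ioi).2 (ae_of_all _ fun x (hx : 0 < x) => ?_)
    simp only [hg, Pi.zero_apply]
    positivity
  have hR : ∫ x in Ioi (0:ℝ), g x = 1 / 2 * ((1 / π) ^ a * Real.Gamma a) := by
    simp only [hg]
    rw [integral_const_mul, key]
  rw [hL, ← hR]
  exact hmono

/-- The two-sided Gamma majorant: for `u ≥ 2`,
`∫ ‖v(t)‖ e^{(u−½)|t|} dt ≤ |C| 2^D π^{−D} · π^{−u/2} Γ(u/2 + D)`. -/
theorem integral_norm_mul_exp_le {D : ℕ} {v : ℝ → ℂ}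
    (hG : (∃ C : ℝ, ∀ t : ℝ,
        ‖v t‖ ≤ C * (1 + Real.exp (2 * |t|)) ^ D * Real.exp (|t| / 2 - π * Real.exp (2 * |t|)))) :
    ∃ C₁ : ℝ, 0 ≤ C₁ ∧ ∀ u : ℝ, 2 ≤ u →
      ∫ t : ℝ, ‖v t‖ * Real.exp ((u - 1 / 2) * |t|) ≤ C₁ * gammaEnv D u := by
  obtain ⟨C, hC⟩ := hG
  refine ⟨|C| * 2 ^ D * (1 / π) ^ (D : ℝ), by positivity, fun u hu => ?_⟩
  set a : ℝ := u / 2 + D with ha_def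
  have ha : 0 < a := by rw [ha_def]; positivity
  -- the envelope with the exponential weight
  set h : ℝ → ℝ := fun x => (1 + Real.exp (2 * x)) ^ D * Real.exp (x / 2 - π * Real.exp (2 * x)) *
    Real.exp ((u - 1 / 2) * x) with hh_def
  have hcont : Continuous h := by rw [hh_def]; fun_prop
  -- step 1–2: ∫ ‖v‖ e^{(u-1/2)|t|} ≤ ∫ |C| h(|t|)
  obtain ⟨K, hK0, hK⟩ := env_abs_mul_exp_le D (u - 1 / 2)
  have hRint : Integrable (fun t : ℝ => |C| * h |t|) := by
    have hKI : Integrable (fun t : ℝ => |C| * K * Real.exp (-(1:ℝ) * |t|)) :=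
      (Literature.Analysis.Complex.integrable_exp_neg_mul_abs (by norm_num : (0:ℝ) < 1)).const_mul _
    refine hKI.mono' ((hcont.comp continuous_abs).aestronglyMeasurable.const_mul |C|)
      (ae_of_all _ fun t => ?_)
    rw [Real.norm_eq_abs, abs_of_nonneg (by rw [hh_def]; positivity)]
    have := hK t
    calc |C| * h |t| ≤ |C| * (K * Real.exp (-(1:ℝ) * |t|)) :=
          mul_le_mul_of_nonneg_left (by simpa [hh_def] using this) (abs_nonneg C)
      _ = |C| * K * Real.exp (-(1:ℝ) * |t|) := by ring
  have h12 : ∫ t : ℝ, ‖v t‖ * Real.exp ((u - 1 / 2) * |t|) ≤ ∫ t : ℝ, |C| * h |t| := by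
    refine integral_mono_of_nonneg (ae_of_all _ fun t => by positivity) hRint
      (ae_of_all _ fun t => ?_)
    have hC' : ‖v t‖ ≤ |C| * ((1 + Real.exp (2 * |t|)) ^ D *
        Real.exp (|t| / 2 - π * Real.exp (2 * |t|))) := by
      refine (hC t).trans ?_
      rw [mul_assoc]
      exact mul_le_mul_of_nonneg_right (le_abs_self C) (by positivity)
    calc ‖v t‖ * Real.exp ((u - 1 / 2) * |t|)
        ≤ |C| * ((1 + Real.exp (2 * |t|)) ^ D * Real.exp (|t| / 2 - π * Real.exp (2 * |t|))) *
            Real.exp ((u - 1 / 2) * |t|) := mul_le_mul_of_nonneg_right hC' (Real.exp_pos _).le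
      _ = |C| * h |t| := by simp only [hh_def]; ring
  -- step 3: symmetry
  have h3 : ∫ t : ℝ, |C| * h |t| = |C| * (2 * ∫ x in Ioi (0:ℝ), h x) := by
    rw [integral_const_mul, integral_comp_abs (f := h)]
  -- step 4: on t > 0 the envelope is ≤ 2^D e^{2at - π e^{2t}}
  have hupI : IntegrableOn (fun t : ℝ => (2:ℝ) ^ D * Real.exp (2 * a * t - π * Real.exp (2 * t)))
      (Ioi 0) :=
    ((integrableOn_expexp a).mono_set Ioi_subset_Ici_self).const_mul _
  have h4 : ∫ x in Ioi (0:ℝ), h x ≤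
      ∫ t in Ioi (0:ℝ), (2:ℝ) ^ D * Real.exp (2 * a * t - π * Real.exp (2 * t)) := by
    refine integral_mono_of_nonneg ?_ hupI ?_
    · exact (ae_restrict_iff' measurableSet_Ioi).2
        (ae_of_all _ fun t _ => by simp only [Pi.zero_apply, hh_def]; positivity)
    · refine (ae_restrict_iff' measurableSet_Ioi).2 (ae_of_all _ fun t (ht : 0 < t) => ?_)
      have hpow : (1 + Real.exp (2 * t)) ^ D ≤ (2:ℝ) ^ D * Real.exp (D * (2 * t)) := by
        rw [Real.exp_nat_mul, ← mul_pow]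
        apply pow_le_pow_left₀ (by positivity)
        linarith [Real.one_le_exp (by positivity : (0:ℝ) ≤ 2 * t)]
      calc h t = (1 + Real.exp (2 * t)) ^ D * (Real.exp (t / 2 - π * Real.exp (2 * t)) *
            Real.exp ((u - 1 / 2) * t)) := by simp only [hh_def]; ring
        _ ≤ (2:ℝ) ^ D * Real.exp (D * (2 * t)) * (Real.exp (t / 2 - π * Real.exp (2 * t)) *
            Real.exp ((u - 1 / 2) * t)) := mul_le_mul_of_nonneg_right hpow (by positivity)
        _ = (2:ℝ) ^ D * Real.exp (2 * a * t - π * Real.exp (2 * t)) := by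
            rw [mul_assoc, ← Real.exp_add, mul_assoc, ← Real.exp_add]
            congr 2; rw [ha_def]; ring
  -- step 5: the Gamma integral
  have h5 : ∫ t in Ioi (0:ℝ), (2:ℝ) ^ D * Real.exp (2 * a * t - π * Real.exp (2 * t)) ≤
      (2:ℝ) ^ D * (1 / 2 * ((1 / π) ^ a * Real.Gamma a)) := by
    rw [integral_const_mul]
    exact mul_le_mul_of_nonneg_left (integral_expexp_le ha) (by positivity)
  -- step 6: constants
  have h6 : (1 / π : ℝ) ^ a * Real.Gamma a = (1 / π) ^ (D : ℝ) * gammaEnv D u := by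
    rw [gammaEnv, ha_def, Real.rpow_add (by positivity : (0:ℝ) < 1 / π), one_div,
      Real.inv_rpow Real.pi_pos.le, ← Real.rpow_neg Real.pi_pos.le, neg_div]
    ring
  calc ∫ t : ℝ, ‖v t‖ * Real.exp ((u - 1 / 2) * |t|)
      ≤ ∫ t : ℝ, |C| * h |t| := h12
    _ = |C| * (2 * ∫ x in Ioi (0:ℝ), h x) := h3
    _ ≤ |C| * (2 * ((2:ℝ) ^ D * (1 / 2 * ((1 / π) ^ a * Real.Gamma a)))) := by
        gcongr; exact h4.trans h5
    _ = |C| * 2 ^ D * (1 / π) ^ (D : ℝ) * gammaEnv D u := by rw [h6]; ring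

/-- **S1 — Mellin side from the tails — PROVED.** -/
theorem mellinSide_of_gaussTail {D : ℕ} {v : ℝ → ℂ} (hv : Measurable v)
    (hG : (∃ C : ℝ, ∀ t : ℝ,
        ‖v t‖ ≤ C * (1 + Real.exp (2 * |t|)) ^ D * Real.exp (|t| / 2 - π * Real.exp (2 * |t|)))) :
    (Differentiable ℂ (weilMellin v) ∧
      (∀ a b : ℝ, ∃ B : ℝ, ∀ s : ℂ, a ≤ s.re → s.re ≤ b → ‖weilMellin v s‖ ≤ B) ∧
      ∃ C : ℝ, 0 ≤ C ∧
        (∀ s : ℂ, 2 ≤ s.re → ‖weilMellin v s‖ ≤ C * gammaEnv D s.re) ∧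
        (∀ s : ℂ, s.re ≤ -1 → ‖weilMellin v s‖ ≤ C * gammaEnv D (1 - s.re))) := by
  have hm : AEStronglyMeasurable v volume := hv.aestronglyMeasurable
  refine ⟨fun s => (hasDerivAt_weilMellin_of_expMoments hm
    (fun A => integrable_norm_mul_exp hm hG A) s).differentiableAt, fun a b => ?_, ?_⟩
  · refine ⟨∫ t : ℝ, ‖v t‖ * Real.exp ((|a| + |b| + 1) * |t|), fun s has hsb =>
      norm_weilMellin_le hm hG (abs_le.2 ⟨?_, ?_⟩)⟩
    · linarith [neg_abs_le a, abs_nonneg b]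
    · linarith [le_abs_self b, abs_nonneg a]
  · obtain ⟨C₁, hC₁, hmain⟩ := integral_norm_mul_exp_le hG
    refine ⟨C₁, hC₁, fun s hs => ?_, fun s hs => ?_⟩
    · refine (norm_weilMellin_le hm hG (M := s.re - 1 / 2) (le_of_eq ?_)).trans (hmain s.re hs)
      exact abs_of_nonneg (by linarith)
    · refine (norm_weilMellin_le hm hG (M := (1 - s.re) - 1 / 2) (le_of_eq ?_)).trans
        (hmain (1 - s.re) (by linarith))
      rw [abs_of_nonpos (by linarith)]; ring

end Summit.RiemannHypothesis.RiemannHypothesis.Theorems.HandoffHRig
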